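import Summits.CriticalPhenomena.SAWScalingLimit.Theses.SAWCompassLattice
import Summits.CriticalPhenomena.SAWScalingLimit.Theorems.SAWLoopFugacityFlowSLECarrier
import Literature.Probability.RandomPlanarGeometry.SLEConvergenceCriterion
import Literature.Probability.RandomPlanarGeometry.LocalMartingaleProofs

/-!
# The identification stubs of the `CompassSLE` skeleton are NECESSARY (crux stmt-CriticalPhenomena-6965,
# line `registered`/`birth`, lead c1)

Honesty certificates for the reshaped skeleton `Cruxes/CompassSLE/Lines/birth.lean` (v3/v4): the open
identification inputs are CONSEQUENCES of the crux (`CompassSLE ↔ YBSquareSLE`,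
`compassSLE_iff_ybSquareSLE`), so promoting them to items is summit-safe.

* `ybSubseqIdentification_of_ybSquareSLE` — `YBSquareSLE` ⇒ every probability subsequential limit law
  of the `π/2` Yang–Baxter curve laws is the chordal SLE(8/3) law (uniqueness of weak limits of
  probability measures on the metric space `CurveClass ℂ`, `ext_of_forall_integral_eq_of_IsFiniteMeasure`);
  this is v1's stub I verbatim.
* `ybSubseqLimitSimple_of_ybSquareSLE` — `YBSquareSLE` ⇒ stub I2b (`stub_ybSubseqLimitSimple`):
  probability subsequential limit laws are carried by simple curves (the SLE(8/3) law is, by the PROVED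
  `SLECarrier_proof`, Rohde–Schramm simplicity for `κ ≤ 4`).

(T-side: T ⇐ `YBSquareSLE` by Le Cam along sequences + finiteness of the walk sets for meshes bounded
below, cf. `ObservableToSLE.Negative.isTightAlongMesh_of_convergesInLawToSLE` for `δℍ`; T1 ⇐ eventual
set-tightness with the shell-dependent threshold — wave-2 worker T1's scratch; I1 ⇐ crux needs the
avoidance-of-limit sandwich of item stmt-11198 — not ported here.)
-/

noncomputable section

namespace Summit.CriticalPhenomena.SAWScalingLimit.Theorems.SAWCompassLatticeCompassSLE

open MeasureTheory Filter Topology Set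
open scoped NNReal ENNReal
open Literature.Probability.RandomPlanarGeometry
open Literature.Probability.RandomPlanarGeometry.SAW.YangBaxter
open Summit.CriticalPhenomena.SAWScalingLimit.Theses

/-- **`YBSquareSLE` forces the identification of subsequential limits** (v1's stub I is necessary):
convergence in law along the mesh filter makes every probability subsequential limit law THE SLE(8/3)
law, by uniqueness of weak limits of probability measures on `CurveClass ℂ`. Registered sub-goal stub
`ybSubseqIdentification_of_ybSquareSLE`. -/
theorem ybSubseqIdentification_of_ybSquareSLE :
    SAWCompassLattice.YBSquareSLE →
    ∀ (D : DobrushinDomain) (a b : ℝ → MidEdge),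
      IsYBEndpointApprox (fun (_ : ℤ) => Real.pi / 2) D a b →
      ∀ μ : Measure (CurveClass ℂ), IsProbabilityMeasure μ →
        IsSubseqLimitLaw
          (fun δ (γ : YangBaxterSAW (fun (_ : ℤ) => Real.pi / 2) D.carrier δ (a δ) (b δ)) =>
            γ.curve (fun (_ : ℤ) => Real.pi / 2) δ)
          (fun δ => ybLaw (fun (_ : ℤ) => Real.pi / 2) D.carrier δ 1 (a δ) (b δ)) μ →
        IsSLELaw ((8 : NNReal) / 3) D μ := by
  intro hY D a b hab μ hμ hsub
  obtain ⟨Γ, hΓ, -, hT⟩ := hY D a b hab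
  obtain ⟨s, hs, hlim⟩ := hsub
  haveI := isProbabilityMeasure_preWienerMeasure'
  haveI : IsProbabilityMeasure (Literature.Probability.Process.preWienerMeasure.map Γ) :=
    Measure.isProbabilityMeasure_map hΓ.aemeasurable
  haveI := hμ
  have key : μ = Literature.Probability.Process.preWienerMeasure.map Γ := by
    apply ext_of_forall_integral_eq_of_IsFiniteMeasure
    intro f
    rw [integral_map hΓ.aemeasurable f.continuous.aestronglyMeasurable]
    exact tendsto_nhds_unique (hlim f) ((hT f).comp hs)
  exact ⟨Γ, hΓ, key⟩

/-- **`YBSquareSLE` forces stub I2b** (`stub_ybSubseqLimitSimple` is necessary): under the crux every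
probability subsequential limit law is the SLE(8/3) law, which is carried by simple curves
(`SLECarrier_proof`, Rohde–Schramm). Registered sub-goal stub `ybSubseqLimitSimple_of_ybSquareSLE`. -/
theorem ybSubseqLimitSimple_of_ybSquareSLE :
    SAWCompassLattice.YBSquareSLE →
    ∀ (D : DobrushinDomain) (a b : ℝ → MidEdge),
      IsYBEndpointApprox (fun (_ : ℤ) => Real.pi / 2) D a b →
      ∀ (s : ℕ → ℝ) (ν : Measure (CurveClass ℂ)), Tendsto s atTop (𝓝[>] (0 : ℝ)) →
        IsProbabilityMeasure ν →
        (∀ f : BoundedContinuousFunction (CurveClass ℂ) ℝ,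
          Tendsto (fun n => ∫ γ, f (γ.curve (fun (_ : ℤ) => Real.pi / 2) (s n))
              ∂(ybLaw (fun (_ : ℤ) => Real.pi / 2) D.carrier (s n) 1 (a (s n)) (b (s n))))
            atTop (𝓝 (∫ x, f x ∂ν))) →
        ∀ᵐ γ ∂ν, γ ∈ CurveClass.simple := by
  intro hY D a b hab s ν hs hν hlim
  have hSLE : IsSLELaw ((8 : NNReal) / 3) D ν :=
    ybSubseqIdentification_of_ybSquareSLE hY D a b hab ν hν ⟨s, hs, hlim⟩
  exact (_root_.Summit.CriticalPhenomena.SAWScalingLimit.Theorems.SLECarrier_proof D ν hSLE).2.mono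
    fun γ h => h.1

end Summit.CriticalPhenomena.SAWScalingLimit.Theorems.SAWCompassLatticeCompassSLE

end
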